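import Mathlib
import Literature.NumberTheory.Sieve.PretentiousDistance

/-!
# Sketch — first lemmas for the crux idea cards on `TupleElliott` (stmt-Parity-14832)

The crux decl is refuted (`InverseSieveTuplesTupleElliott_refuted`, shift-divisor blindness);
these Props are the first checkable statements of the three levers filed in `Ideas/`, aimed at
the intended content (uniform Hardy–Littlewood–Elliott along affine systems) and at any restated
successor. They only need to ELABORATE here (crux-ideate stage); none is proved.
-/

namespace Summit.Parity.GeneralizedHardyLittlewood.Cruxes.TupleElliott.IdeaSketch

open scoped BigOperators ComplexConjugate
open Literature.NumberTheory.Sieve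

/-- Card `exceptional-conductor-split`, first lemma (U1, Karatsuba class; provable-grade):
character sums over shifted primes `∑_{p ≤ N} χ(ap+b) log p` are `o(N)` uniformly for primitive
`χ` of conductor `q ∈ [A₀, LN]` COPRIME to `ab` (then `ap + b` is a genuinely shifted argument
mod every prime factor of `q`; Karatsuba 1970 for prime `q`, `N ≥ q^{1/2+ε}`;
Rakhmonov / Friedlander–Gong–Shparlinski / Kerr for composite `q`; Siegel–Walfisz for
`q ≤ (log N)^C`). Exceptional zeros are irrelevant to this class (bilinear proofs). -/
def ShiftedPrimeCharSum : Prop :=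
  ∀ (L : ℕ) (η : ℝ), 0 < η → ∃ A₀ : ℝ, ∃ N₀ : ℕ, ∀ N : ℕ, N₀ ≤ N →
    ∀ a b : ℤ, a ≠ 0 → |a| ≤ L → |b| ≤ L * N →
    ∀ (q : ℕ) [NeZero q] (χ : DirichletCharacter ℂ q), χ.IsPrimitive →
      A₀ ≤ (q : ℝ) → (q : ℝ) ≤ L * N → Nat.Coprime q (a * b).natAbs →
      ‖∑ p ∈ Nat.primesLE N, (Real.log p : ℂ) * χ (((a : ℤ) * p + b : ℤ) : ZMod q)‖ ≤ η * N

/-- Card `exceptional-conductor-split`, the complementary atom (U2, zero-dependent class): for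
`q ∣ D(Ψ)` the same instances collapse to UNSHIFTED prime character sums, e.g. `Ψ = (n, n+q)`,
`f = χ_q`: `∑_{p ≤ N} χ(p+q) log p = ψ(N, χ)`. The narrow-exemption uniform HLE therefore contains
this statement, which in turn contains "no exceptional zero at the Landau–Page scale"
(`(1-β_q) log q → ∞`) and PNT for individual characters of conductor up to `LN` at length `N`
(known for `q ≤ N^{c}` off the exceptional character: Linnik–Gallagher, tree
`gallagher_nonexceptional_threshold`; open beyond). -/
def CharPNTShort : Prop :=
  ∀ (L : ℕ) (η : ℝ), 0 < η → ∃ A₀ : ℝ, ∃ N₀ : ℕ, ∀ N : ℕ, N₀ ≤ N →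
    ∀ (q : ℕ) [NeZero q] (χ : DirichletCharacter ℂ q), χ ≠ 1 →
      A₀ ≤ (q : ℝ) → (q : ℝ) ≤ L * N →
      ‖∑ p ∈ Nat.primesLE N, (Real.log p : ℂ) * χ (p : ZMod q)‖ ≤ η * N

/-- Card `smooth-conditioning-rough-elliott`, first lemma (Case S at `t = 1`; provable-grade from
Bombieri–Vinogradov + the fundamental lemma + Kubilius/Turán–Kubilius on shifted primes): if `f`
is trivial on the primes above `z = N^{1/v}` and its distance from `1` carried by the primes
`p ≤ z`, `p ∤ ab`, is `≥ A`, then `∑_{p ≤ N} f(ap+b) log p` is at most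
`C (e^{-cA} + e^{-cv}) N` eventually. (The primes dividing `ab` are invisible on the sifted
support — exactly the mechanism of the refutation witness, which this lemma prices correctly.) -/
def SmoothCaseShiftedPrimes : Prop :=
  ∃ C c : ℝ, 0 < c ∧ ∀ (L : ℕ) (A : ℝ) (v : ℕ), 1 ≤ A → 2 ≤ v → ∃ N₀ : ℕ, ∀ N : ℕ, N₀ ≤ N →
    ∀ a b : ℤ, 0 < a → a ≤ L → |b| ≤ L * N → Int.gcd a b = 1 →
    ∀ f : ArithmeticFunction ℂ, f.IsMultiplicative → (∀ n, ‖f n‖ ≤ 1) →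
      (∀ p : ℕ, p.Prime → (N : ℝ) ^ (1 / (v : ℝ)) < p → ∀ k : ℕ, 1 ≤ k → f (p ^ k) = 1) →
      A ≤ ∑ p ∈ (Nat.primesLE ⌊(N : ℝ) ^ (1 / (v : ℝ))⌋₊).filter (fun p : ℕ => ¬ ((p : ℤ) ∣ a * b)),
            (1 - (f p).re) / (p : ℝ) →
      ‖∑ p ∈ Nat.primesLE N, (Real.log p : ℂ) * f (((a : ℤ) * p + b).toNat)‖ ≤
        C * (Real.exp (-c * A) + Real.exp (-c * v)) * N

/-- Card `harman-opening-prime-free-transfer`, transfer target (T2″) at `t = 1` in its plain form: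
binary correlations of `f` along DILATED pairs `(amn+b, amn'+b)` average to `o` over the dilation
pair `(n, n')` in every Type-II window `M ∈ [N^δ, N^{1/2}]`, for `f` far from all twisted
characters of conductor `≤ N` (the WIDE exemption — with the narrow one the statement is false
for `f = χ_q`, `q ∣ b`, the same blindness as in the refutation). Prime-free. -/
def DilationPairElliott : Prop :=
  ∀ (L : ℕ) (δ η : ℝ), 0 < δ → δ < 1 / 4 → 0 < η → ∃ A₀ : ℝ, ∃ N₀ : ℕ, ∀ N : ℕ, N₀ ≤ N →
    ∀ a b : ℤ, a ≠ 0 → |a| ≤ L → |b| ≤ L * N →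
    ∀ f : ArithmeticFunction ℂ, f.IsMultiplicative → (∀ n, ‖f n‖ ≤ 1) →
      (∀ (q : ℕ) (χ : DirichletCharacter ℂ q) (τ : ℝ), 1 ≤ q → (q : ℝ) ≤ N → |τ| ≤ N →
          A₀ ≤ pretentiousDistSq (⇑f) (twistedChar χ τ) N) →
      ∀ M : ℕ, (N : ℝ) ^ δ ≤ M → (M : ℝ) ≤ (N : ℝ) ^ (1 / 2 : ℝ) →
        ∑ n ∈ Finset.Ioc (N / M) (2 * (N / M)), ∑ n' ∈ Finset.Ioc (N / M) (2 * (N / M)),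
            ‖∑ m ∈ Finset.Ioc M (2 * M),
                f (((a : ℤ) * m * n + b).toNat) * conj (f (((a : ℤ) * m * n' + b).toNat))‖
          ≤ η * ((N / M : ℕ) : ℝ) ^ 2 * M

/-- Card `harman-opening-prime-free-transfer`, Type-I companion (Granville–Shao-type
Bombieri–Vinogradov for a `1`-bounded multiplicative `f` in a FIXED residue class per modulus,
interval form, relative to the wide exemption; provable-grade from Granville–Shao 2019). -/
def TypeOneForMultiplicative : Prop :=
  ∀ (L : ℕ) (ε : ℝ) (B : ℝ), 0 < ε → ∃ A₀ : ℝ, ∃ N₀ : ℕ, ∀ N : ℕ, N₀ ≤ N →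
    ∀ b : ℤ, |b| ≤ L * N →
    ∀ f : ArithmeticFunction ℂ, f.IsMultiplicative → (∀ n, ‖f n‖ ≤ 1) →
      (∀ (q : ℕ) (χ : DirichletCharacter ℂ q) (τ : ℝ), 1 ≤ q → (q : ℝ) ≤ N → |τ| ≤ N →
          A₀ ≤ pretentiousDistSq (⇑f) (twistedChar χ τ) N) →
      ∀ y : ℕ → ℕ, (∀ d, y d ≤ N) →
        ∑ d ∈ Finset.Icc 1 ⌊(N : ℝ) ^ (1 / 2 - ε)⌋₊,
            ‖∑ n ∈ (Finset.Icc 1 (y d)).filter (fun n : ℕ => (n : ℤ) ≡ b [ZMOD (d : ℤ)]), f n‖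
          ≤ (N : ℝ) / Real.log N ^ B + (N : ℝ) * Real.exp (-A₀)

end Summit.Parity.GeneralizedHardyLittlewood.Cruxes.TupleElliott.IdeaSketch
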